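import Summits.ABC.IUTFork.Cor312SlotHullLocal
import Summits.ABC.IUTFork.Cor312ThetaLocalGeContentHull
import Summits.ABC.IUTFork.Cor312ThetaLocalGeContentHullSharp
import HarnessLib

/-!
# [IUTchIII] Corollary 3.12 IN READING (P) — the SLOT-HULL local term of ANY typed setting over a `p`-adic presentation is bounded BELOW
# by the per-summand content hulls of the region's OWN contents: `Σ_{v⃗} w(v⃗)·(−m(v⃗)·log p + log μ̄_{v⃗}(hull(log_p(R_{v⃗}^×)))) ≤ −|log(Θ)|^{(P)}_{j,v_ℚ}`

PROOF-ONLY file (D-0012; no definitions, no `Prop` facts) of the abc-iut cell (R2 S-chain team, seat abc-iut-s2-p7 gen 3, CLAIM «HΘP-K»: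
the READ-P binder `hReadP` of abc-iut-C-cert-2's γ certificate `Conditional.abc_of_slotLicence_orNumP_K_szpiroBad`, p458998). The
(Ind2)-SLOT-HULL twin of abc-iut-s2-p9's `Cor312ThetaLocalGeContentHull` (p448133) / `Cor312ThetaLocalGeContentHullSharp` (p450136). TAKES NO
SIDE on [IUTchIII] Cor. 3.12 or on the reading (U)/(P) of `−|log(Θ)|`.

S. Mochizuki, *Inter-universal Teichmüller theory III* [Mochizuki2012]: Thm. 3.11 (i) (Ind2) p. 154, Cor. 3.12 proof Step (x) p. 181;
*IUT IV* Thm. 1.10 Step (v) p. 27–28; T. Dupuy, A. Hilado [DupuyHilado2025] §3.7, §3.9 (the idele acts through the LAST tensor factor), §4.9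
(Ism = ALL lattice automorphisms), §4.12; A. Weil [WeilBNT1967] Ch. II §2 Th. 2. For a setting `P` whose hull frame at `(j, v_ℚ)`, `j = i+1`,
is the pulled-back real frame of a presentation `Pr` (`hframe`) with the weighted summand log-measure (`hvol`) and a hull for the slot union
(`hdef`):

* **`sum_content_hull_le_thetaSlotLocal_untopD`** — if every summand `v⃗` carries, IN THE (Ind3)-REGION ITSELF, a point whose `v⃗`-component
  has content EXACTLY `p^{m(v⃗)}` (`hwit`), and every factorwise family of shell-preserving `ℚ_p`-linear automorphisms is realised on `v⃗` by
  an (Ind2)-FAMILY (`hism`), then the reverse inequality holds: abc-iut-s2-p9's factorwise orbit-span engine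
  (`smul_logPacket_subset_closure_factorwiseOrbit`, p447236) run inside `S.L.Ind2Family` — translates of points of the region by
  (Ind2)-families ARE slot images, so NO closure of the families under composition is needed;
* `exists_ind2Family_comparison_eq_congr` — `hism` from FULLNESS of Ism (abc-iut-s2-p9's construction `exists_indGroup_comparison_eq_congr`
  VERBATIM: it builds an (Ind2)-family; here its membership in `S.L.Ind2Family` is recorded instead of in the generated group);
* `exists_mem_thetaRegion3_comparison_eq`, `exists_mem_thetaRegion3_exact_content_of_sharpBox` — `hwit` for a product of boxes / for
  abc-iut-s2-p8's SHARP region `e⁻¹(Π_{v⃗} ι_{i+1}(t_{i,v_{i+1}})·(R_I)^∼)`: the exact-content vector of the LAST-slot box, put at `v⃗` and `0`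
  elsewhere, is a point of the region (no (Ind1)-permutation, unlike the slot-union witness of p450136).

[cite: Mochizuki2012, IUTchIII Thm. 3.11 (i) (Ind2) p. 154; Cor. 3.12 proof Step (x) p. 181] [cite: Mochizuki2012, IUTchIV Thm. 1.10 Step (v)
p. 27–28] [cite: DupuyHilado2025, §3.7, §3.9, §4.9, §4.12] [cite: WeilBNT1967, Ch. II §2, Th. 2] [claim: Mochizuki2012, status: disputed] for
every quoted construction. HONEST FRAMING: an inequality between OUR typed objects; nothing here asserts or denies Cor. 3.12 or takes a
side on any author; typed ≠ proved.
-/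

noncomputable section

open Set Function
open scoped Pointwise

namespace Summit.ABC.IUTFork.Cor312Vol

open Thm311 Cor312 Literature.IUT.LogThetaLattice Literature.IUT.LogVolume PadicPresentation

section Setting

variable {T : ThetaIndex} {S : Situation T} {P : Cor312.Setting S} {vQ : T.VQ} {p : ℕ} [hp : Fact p.Prime]
  (Pr : PadicPresentation S.L vQ p)


/-! ## §1. The LOWER bound: the factorwise orbit-span engine run inside the (Ind2)-families -/

/-- **`Σ_{v⃗} w(v⃗)·(−m(v⃗)·log p + log μ̄_{v⃗}(hull(log_p(R_{v⃗}^×)))) ≤ (−|log(Θ)|^{(P)}_{j,v_ℚ}).untopD 0`** — the slot twin of abc-iut-s2-p9's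
`sum_content_hull_le_thetaLocal_untopD` (p448133). Let the hull frame of `P` at `(j, v_ℚ)`, `j = i+1`, be the pulled-back real frame of
`Pr` (`hframe`) with the weighted summand log-measure (`hvol`), and let the union of the (Ind2)-slot images admit its hull (`hdef`). Suppose
(`hwit`) every summand `v⃗` carries, IN THE (Ind3)-REGION ITSELF, a point whose `v⃗`-component has content EXACTLY `p^{m(v⃗)}`, and (`hism`)
every factorwise family `⊗_a g'_a` of shell-preserving `ℚ_p`-linear automorphisms of the `K_{v⃗ a}` is realised on the summand `v⃗` by an
(Ind2)-FAMILY. Then the slot hull — a hull-set `e⁻¹(Π_{v⃗} ψ_{v⃗}⁻¹(λ_{v⃗}·𝒪))` — has summand components containing the factorwise orbit of that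
point (translates of points of the region by (Ind2)-families ARE slot images: no composition of families is needed), hence its `ℤ`-span
`p^{m(v⃗)}·log_p(R_{v⃗}^×)` (abc-iut-s2-p9 `smul_logPacket_subset_closure_factorwiseOrbit`, p447236), hence `hull(p^{m(v⃗)}·log_p(R_{v⃗}^×))`, and
the weighted log-measures compare. [cite: Mochizuki2012, IUTchIII Thm. 3.11 (i) (Ind2) p. 154; Cor. 3.12 proof Step (x) p. 181]
[cite: Mochizuki2012, IUTchIV Thm. 1.10 Step (v) p. 27–28] [cite: DupuyHilado2025, §4.9, §4.12] -/
theorem sum_content_hull_le_thetaSlotLocal_untopD (i : Fin T.lstar)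
    [Fintype (Pr.factorIdx (Cor312.Setting.labelSucc i))] [Fintype (T.Caps (Cor312.Setting.labelSucc i) → T.Fibre vQ)]
    (hdef : P.SlotHullDefined (Cor312.Setting.labelSucc i) vQ)
    (hframe : P.frame (Cor312.Setting.labelSucc i) vQ =
      HullFrame.ofComparison (Pr.factorField (Cor312.Setting.labelSucc i))
        (fun x => Pr.factorMap (Cor312.Setting.labelSucc i) x))
    (hvol : ∀ R : ∀ e : T.Caps (Cor312.Setting.labelSucc i) → T.Fibre vQ, Set (Pr.X e),
      (∀ e, PacketAdm p (Pr.kk e) (R e)) →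
        (S.D P.n).logvol (Cor312.Setting.labelSucc i) vQ
          (Pr.comparison (Cor312.Setting.labelSucc i) ⁻¹' Set.pi univ R) =
        ∑ e, Pr.w (Cor312.Setting.labelSucc i) e * packetLogμ p (Pr.kk e) (R e))
    (m : (T.Caps (Cor312.Setting.labelSucc i) → T.Fibre vQ) → ℤ)
    (hwit : ∀ e : T.Caps (Cor312.Setting.labelSucc i) → T.Fibre vQ, ∃ x ∈ P.thetaRegion3 (Cor312.Setting.labelSucc i) vQ,
      Pr.comparison (Cor312.Setting.labelSucc i) x e ∈ ((p : ℚ_[p]) ^ m e) • (logPacket p (Pr.kk e) : Set (Pr.X e)) ∧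
      Pr.comparison (Cor312.Setting.labelSucc i) x e ∉ ((p : ℚ_[p]) ^ (m e + 1)) • (logPacket p (Pr.kk e) : Set (Pr.X e)))
    (hism : ∀ (e : T.Caps (Cor312.Setting.labelSucc i) → T.Fibre vQ) (g' : ∀ a, Pr.kk e a ≃ₗ[ℚ_[p]] Pr.kk e a),
      (∀ a, g' a '' logUnits (Pr.kk e a) = logUnits (Pr.kk e a)) →
      ∃ Φ ∈ S.L.Ind2Family, ∀ x, Pr.comparison (Cor312.Setting.labelSucc i) (Φ (Cor312.Setting.labelSucc i) vQ x) e =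
        (PiTensorProduct.congr g' : Pr.X e ≃ₗ[ℚ_[p]] Pr.X e) (Pr.comparison (Cor312.Setting.labelSucc i) x e)) :
    ∑ e, Pr.w (Cor312.Setting.labelSucc i) e * (-(m e * Real.log p) +
        packetLogμ p (Pr.kk e) (packetHull p (Pr.kk e) (logPacket p (Pr.kk e) : Set (Pr.X e)))) ≤
      (P.thetaSlotLocal (Cor312.Setting.labelSucc i) vQ).untopD 0 := by
  classical
  haveI : Nonempty (T.Caps (Cor312.Setting.labelSucc i)) := ⟨0⟩
  -- the local slot term is the log-volume of the slot hull
  have hloc := P.thetaSlotLocal_untopD_eq hdef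
  -- the slot hull is a hull-set of the pulled-back real frame: `e⁻¹(Π_{v⃗} ψ_{v⃗}⁻¹(λ_{v⃗}·𝒪))`
  have hmem : P.thetaSlotHull (Cor312.Setting.labelSucc i) vQ ∈ (P.frame (Cor312.Setting.labelSucc i) vQ).Hul :=
    (P.frame (Cor312.Setting.labelSucc i) vQ).hull_mem_of_hasHull hdef.1 hdef.2
  rw [hframe] at hmem
  obtain ⟨H', hH', hH⟩ : ∃ H' ∈ (HullFrame.ofLocalFields (Pr.factorField (Cor312.Setting.labelSucc i))).Hul,
      P.thetaSlotHull (Cor312.Setting.labelSucc i) vQ = (fun x => Pr.factorMap (Cor312.Setting.labelSucc i) x) ⁻¹' H' := hmem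
  obtain ⟨c, hc, rfl⟩ := (HullFrame.mem_ofLocalFields_hul _).mp hH'
  rw [Pr.factorMap_preimage_hullSet] at hH
  have hWadm : ∀ e : T.Caps (Cor312.Setting.labelSucc i) → T.Fibre vQ, PacketAdm p (Pr.kk e)
      (dEquiv p (Pr.kk e) ⁻¹' hullSet (DFac p (Pr.kk e)) fun i' => c ⟨e, i'⟩) :=
    fun e => Pr.packetAdm_preimage_hullSet e _ fun i' => hc ⟨e, i'⟩
  rw [hloc, hH, hvol _ hWadm]
  refine Finset.sum_le_sum fun e _ => mul_le_mul_of_nonneg_left ?_ (Pr.w_nonneg _ e)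
  rw [← packetLogμ_packetHull_zpow_smul_logPacket p (Pr.kk e) (m e)]
  refine packetLogμ_mono p (Pr.kk e) (packetAdm_packetHull_zpow_smul_logPacket p (Pr.kk e) (m e)) (hWadm e) ?_
  -- the summand component `W_{v⃗}` of the slot hull contains the projection of the union of the slot images …
  have hUW : ∀ x ∈ ⋃₀ P.thetaSlotImages (Cor312.Setting.labelSucc i) vQ,
      Pr.comparison (Cor312.Setting.labelSucc i) x e ∈
        dEquiv p (Pr.kk e) ⁻¹' hullSet (DFac p (Pr.kk e)) fun i' => c ⟨e, i'⟩ := by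
    intro x hx
    have hx' : x ∈ P.thetaSlotHull (Cor312.Setting.labelSucc i) vQ := (P.frame (Cor312.Setting.labelSucc i) vQ).subset_hull _ hx
    rw [hH, Set.mem_preimage, Set.mem_univ_pi] at hx'
    exact hx' e
  -- … which contains the factorwise orbit of the projection of the (Ind3)-region (translates by (Ind2)-families are slot images) …
  have hstab : ∀ g' : ∀ a, Pr.kk e a ≃ₗ[ℚ_[p]] Pr.kk e a, (∀ a, g' a '' logUnits (Pr.kk e a) = logUnits (Pr.kk e a)) →
      (PiTensorProduct.congr g' : Pr.X e ≃ₗ[ℚ_[p]] Pr.X e) ''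
          ((fun x => Pr.comparison (Cor312.Setting.labelSucc i) x e) '' P.thetaRegion3 (Cor312.Setting.labelSucc i) vQ) ⊆
        (fun x => Pr.comparison (Cor312.Setting.labelSucc i) x e) '' ⋃₀ P.thetaSlotImages (Cor312.Setting.labelSucc i) vQ := by
    intro g' hg'
    obtain ⟨Φ, hΦ, hΦe⟩ := hism e g' hg'
    rintro _ ⟨_, ⟨y, hy, rfl⟩, rfl⟩
    exact ⟨Φ (Cor312.Setting.labelSucc i) vQ y,
      Set.mem_sUnion.mpr ⟨Φ (Cor312.Setting.labelSucc i) vQ '' P.thetaRegion3 (Cor312.Setting.labelSucc i) vQ, ⟨Φ, hΦ, rfl⟩,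
        Set.mem_image_of_mem _ hy⟩, hΦe y⟩
  -- … and the region's projection contains a vector of content exactly `p^{m(v⃗)}`: so `W_{v⃗} ⊇ p^{m(v⃗)}·log_p(R_{v⃗}^×)` …
  obtain ⟨x, hxR, hxm, hxm1⟩ := hwit e
  have hA := smul_logPacket_subset_closure_factorwiseOrbit p (Pr.kk e)
    (M := (fun x => Pr.comparison (Cor312.Setting.labelSucc i) x e) '' P.thetaRegion3 (Cor312.Setting.labelSucc i) vQ)
    (Set.mem_image_of_mem _ hxR) hxm (zpow_content p (Pr.kk e) hxm hxm1).2
  have hMW : packetHull p (Pr.kk e)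
      ((fun x => Pr.comparison (Cor312.Setting.labelSucc i) x e) '' ⋃₀ P.thetaSlotImages (Cor312.Setting.labelSucc i) vQ) ⊆
        dEquiv p (Pr.kk e) ⁻¹' hullSet (DFac p (Pr.kk e)) fun i' => c ⟨e, i'⟩ :=
    Pr.packetHull_subset_preimage_hullSet e _ (by rintro _ ⟨x, hx, rfl⟩; exact hUW x hx)
  have hΛW : ((p : ℚ_[p]) ^ m e) • (logPacket p (Pr.kk e) : Set (Pr.X e)) ⊆
      dEquiv p (Pr.kk e) ⁻¹' hullSet (DFac p (Pr.kk e)) fun i' => c ⟨e, i'⟩ := by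
    refine hA.trans fun y hy => hMW ?_
    have hle : AddSubgroup.closure (⋃ g' ∈ {g' : ∀ a, Pr.kk e a ≃ₗ[ℚ_[p]] Pr.kk e a |
          ∀ a, g' a '' logUnits (Pr.kk e a) = logUnits (Pr.kk e a)},
        (PiTensorProduct.congr g' : Pr.X e ≃ₗ[ℚ_[p]] Pr.X e) ''
          ((fun x => Pr.comparison (Cor312.Setting.labelSucc i) x e) '' P.thetaRegion3 (Cor312.Setting.labelSucc i) vQ)) ≤
        (packetSpan p (Pr.kk e) ((fun x => Pr.comparison (Cor312.Setting.labelSucc i) x e) ''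
          ⋃₀ P.thetaSlotImages (Cor312.Setting.labelSucc i) vQ)).toAddSubgroup := by
      rw [AddSubgroup.closure_le]
      exact (Set.iUnion₂_subset fun g' hg' => hstab g' hg').trans (subset_packetHull p (Pr.kk e) _)
    exact hle hy
  -- … hence `hull(p^{m(v⃗)}·log_p(R_{v⃗}^×))`
  exact Pr.packetHull_subset_preimage_hullSet e _ hΛW

/-! ## §2. Dischargers for `hism` and `hwit` -/

/-- **`hism` from FULLNESS of Ism, landing in the (Ind2)-FAMILIES.** If every shell-preserving `ℚ_p`-linear automorphism of a `K_v` is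
(intertwined with) an element of `Ism_v` (`hfull` — Dupuy–Hilado §4.9: Ism = ALL bicontinuous lattice automorphisms of `I_v`), then every
factorwise family `⊗_a g'_a` on the summand `v⃗` is realised there by an (Ind2)-FAMILY: pad `g'_a` by identities off the summand `v⃗ a`,
take the (Ind2) element `⊗_a ⊕_v g_{a,v}` at `(j, v_ℚ)` padded by identities at the other `(j', v_ℚ')`, and read it through the comparison
(abc-iut-c312-5 `comparison_factorwise`). abc-iut-s2-p9's construction `exists_indGroup_comparison_eq_congr` (p448133) VERBATIM, recording
its membership in `S.L.Ind2Family` rather than in the generated group. [cite: DupuyHilado2025, §4.9]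
[cite: Mochizuki2012, IUTchIII Thm. 3.11 (i) (Ind2) p. 154] -/
theorem exists_ind2Family_comparison_eq_congr (j : T.Label)
    (hfull : ∀ (v : T.Fibre vQ) (g' : Pr.k v ≃ₗ[ℚ_[p]] Pr.k v), g' '' logUnits (Pr.k v) = logUnits (Pr.k v) →
      ∃ g ∈ S.L.ism v.1, ∀ x, Pr.φ v (g x) = g' (Pr.φ v x))
    (e : T.Caps j → T.Fibre vQ) (g' : ∀ a, Pr.kk e a ≃ₗ[ℚ_[p]] Pr.kk e a)
    (hg' : ∀ a, g' a '' logUnits (Pr.kk e a) = logUnits (Pr.kk e a)) :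
    ∃ Φ ∈ S.L.Ind2Family, ∀ x, Pr.comparison j (Φ j vQ x) e =
      (PiTensorProduct.congr g' : Pr.X e ≃ₗ[ℚ_[p]] Pr.X e) (Pr.comparison j x e) := by
  classical
  -- `g'_a` on the summand `v⃗ a` of the factor `a`, identities on the other summands
  let g'' : T.Caps j → ∀ v : T.Fibre vQ, Pr.k v ≃ₗ[ℚ_[p]] Pr.k v :=
    fun a => Function.update (fun v => LinearEquiv.refl ℚ_[p] (Pr.k v)) (e a) (g' a)
  have hg''e : ∀ a, g'' a (e a) = g' a := fun a => by simp only [g'', Function.update_self]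
  have hlog'' : ∀ a v, g'' a v '' logUnits (Pr.k v) = logUnits (Pr.k v) := by
    intro a v
    by_cases hv : v = e a
    · subst hv
      rw [hg''e]
      exact hg' a
    · have h : g'' a v = LinearEquiv.refl ℚ_[p] (Pr.k v) := Function.update_of_ne hv _ _
      rw [h]
      exact Set.image_id' _ ▸ Set.image_congr fun x _ => rfl
  choose g hgism hgφ using fun a v => hfull v (g'' a v) (hlog'' a v)
  -- the (Ind2) element at `(j, v_ℚ)`, padded by identities elsewhere
  let Φ : S.L.PacketAut := Function.update (fun j' => fun vQ' => LinearEquiv.refl ℚ (S.L.Packet j' vQ')) j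
    (Function.update (fun vQ' => LinearEquiv.refl ℚ (S.L.Packet j vQ')) vQ
      (S.L.factorwise j vQ fun a => S.L.summandwise vQ (g a)))
  have hΦj : Φ j vQ = S.L.factorwise j vQ (fun a => S.L.summandwise vQ (g a)) := by
    simp only [Φ, Function.update_self]
  have hΦ2 : Φ ∈ S.L.Ind2Family := by
    intro j' vQ'
    by_cases hj : j' = j
    · subst hj
      by_cases hv : vQ' = vQ
      · subst hv
        rw [hΦj]
        exact ⟨g, hgism, rfl⟩
      · have h : Φ j' vQ' = LinearEquiv.refl ℚ _ := by
          simp only [Φ, Function.update_self, Function.update_of_ne hv]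
        rw [h]
        exact S.L.refl_mem_Ind2 j' vQ'
    · have h : Φ j' vQ' = LinearEquiv.refl ℚ _ := by
        simp only [Φ, Function.update_of_ne hj]
      rw [h]
      exact S.L.refl_mem_Ind2 j' vQ'
  refine ⟨Φ, hΦ2, fun x => ?_⟩
  rw [hΦj, Pr.comparison_factorwise g g'' hgφ x]
  simp only [hg''e]

/-- **`hwit` from PRODUCT BOXES, inside the (Ind3)-region.** If the (Ind3)-region contains the preimage `e⁻¹(Π_{v⃗} B_{v⃗})` of a product
of boxes each containing `0`, then for every summand `v⃗` and `z ∈ B_{v⃗}` some point OF THE REGION has `v⃗`-component `z`: put `z` at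
`v⃗` and `0` elsewhere and pull back along the (surjective) comparison. [cite: DupuyHilado2025, §4.7] -/
theorem exists_mem_thetaRegion3_comparison_eq (j : T.Label)
    (B : ∀ e : T.Caps j → T.Fibre vQ, Set (Pr.X e)) (hB : Pr.comparison j ⁻¹' Set.pi univ B ⊆ P.thetaRegion3 j vQ)
    (hB0 : ∀ e, (0 : Pr.X e) ∈ B e) (e : T.Caps j → T.Fibre vQ) {z : Pr.X e} (hz : z ∈ B e) :
    ∃ x ∈ P.thetaRegion3 j vQ, Pr.comparison j x e = z := by
  classical
  obtain ⟨x₀, hx₀⟩ := Pr.comparison_surjective j (Function.update (fun e' => (0 : Pr.X e')) e z)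
  refine ⟨x₀, hB ?_, by rw [hx₀, Function.update_self]⟩
  rw [Set.mem_preimage, hx₀, Set.mem_univ_pi]
  intro e'
  by_cases h : e' = e
  · subst h
    rw [Function.update_self]
    exact hz
  · rw [Function.update_of_ne h]
    exact hB0 e'

/-- **Exact-content witnesses IN a SHARP (Ind3)-region** `e⁻¹(Π_{v⃗} sharpBox_{v⃗})` (abc-iut-s2-p8 `PadicPresentation.sharpBox`): for every
summand `v⃗` at `(i+1, v_ℚ)` and every exact content exponent `m` of the LAST-slot box `ι_{i+1}(t_{i,v⃗ last})·(R_I)^∼`, some point of the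
region has `v⃗`-component in `p^m·log_p(R_{v⃗}^×) ∖ p^{m+1}·log_p(R_{v⃗}^×)` (`0` lies in every box). The reading-(P) twin of abc-iut-s2-p9's
`exists_mem_sUnion_possibleImages_exact_content_of_sharpBox` (p450136; there: the slot UNION, reached by an (Ind1)-permutation).
[cite: DupuyHilado2025, §3.7, §3.9, §4.12] -/
theorem exists_mem_thetaRegion3_exact_content_of_sharpBox (t : Fin T.lstar → ∀ x : T.Fibre vQ, Pr.k x) (i : Fin T.lstar)
    (hR3 : P.thetaRegion3 (Cor312.Setting.labelSucc i) vQ =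
      Pr.comparison (Cor312.Setting.labelSucc i) ⁻¹' Set.pi univ (Pr.sharpBox t (Cor312.Setting.labelSucc i)))
    (e : T.Caps (Cor312.Setting.labelSucc i) → T.Fibre vQ) (m : ℤ)
    (hm0 : iota p (Pr.kk e) (Fin.last _) (t i (e (Fin.last _))) • (normalizedPacket p (Pr.kk e) : Set (Pr.X e)) ⊆
      ((p : ℚ_[p]) ^ m) • (logPacket p (Pr.kk e) : Set (Pr.X e)))
    (hm1 : ¬ iota p (Pr.kk e) (Fin.last _) (t i (e (Fin.last _))) • (normalizedPacket p (Pr.kk e) : Set (Pr.X e)) ⊆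
      ((p : ℚ_[p]) ^ (m + 1)) • (logPacket p (Pr.kk e) : Set (Pr.X e))) :
    ∃ x ∈ P.thetaRegion3 (Cor312.Setting.labelSucc i) vQ,
      Pr.comparison (Cor312.Setting.labelSucc i) x e ∈ ((p : ℚ_[p]) ^ m) • (logPacket p (Pr.kk e) : Set (Pr.X e)) ∧
        Pr.comparison (Cor312.Setting.labelSucc i) x e ∉ ((p : ℚ_[p]) ^ (m + 1)) • (logPacket p (Pr.kk e) : Set (Pr.X e)) := by
  classical
  obtain ⟨y, hyB, hy1⟩ := Set.not_subset.mp hm1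
  have hy0 := hm0 hyB
  have hbox : Pr.sharpBox t (Cor312.Setting.labelSucc i) e =
      iota p (Pr.kk e) (Fin.last _) (t i (e (Fin.last _))) • (normalizedPacket p (Pr.kk e) : Set (Pr.X e)) := by
    rw [PadicPresentation.sharpBox, PadicPresentation.labelIdele_labelSucc]
  have hB0 : ∀ e', (0 : Pr.X e') ∈ Pr.sharpBox t (Cor312.Setting.labelSucc i) e' :=
    fun e' => Set.mem_smul_set.mpr ⟨0, Subring.zero_mem _, smul_zero _⟩
  obtain ⟨x, hxR, hx⟩ := exists_mem_thetaRegion3_comparison_eq (P := P) Pr (Cor312.Setting.labelSucc i)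
    (Pr.sharpBox t (Cor312.Setting.labelSucc i)) (subset_of_eq hR3.symm) hB0 e (z := y) (by rw [hbox]; exact hyB)
  refine ⟨x, hxR, ?_⟩
  rw [hx]
  exact ⟨hy0, hy1⟩

end Setting

end Summit.ABC.IUTFork.Cor312Vol

end

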